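import Summits.QuantumFields.YangMills.Theorems.BalabanLadderUVSeamRecUnitTransferTwoPoint
import Summits.QuantumFields.YangMills.Theorems.BalabanLadderUVSeamRecUnitTransferThreePoint
import HarnessLib

/-!
# Crux `UVSeamRec` (stmt-QuantumFields-20043), stub `stub_floors`: unit transfer of the floors — IV, the theorems

Helper file (`--supports stmt-QuantumFields-20043`), part IV (conclusions) of the series
`BalabanLadderUVSeamRecUnitTransfer*`.

WHAT THE PINNED UNIT COSTS (the series `BalabanLadderUVSeamRecUnitTransfer*`).  The registered stub `stub_floors` of
crux `UVSeamRec` (stmt-QuantumFields-20043) asks for the non-triviality floors `LowerBounds SU(2) r uRec` at the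
two-loop unit of record `uRec`.  Any engine (the NT line's femto package through the landed `stub_lower`, or Track A's
N32′) delivers floors at ITS OWN unit `a`, with COMPACTLY SUPPORTED bump witnesses (all `stub_lower` ever produces).
The series proves that such floors move to any unit `u` with `a β / u β → c₀ ∈ (0, ∞)` (asymptotic two-loop scaling of
the engine's unit up to a constant) PROVIDED the density ceilings `MomentBounds G r u` (a fortiori the plane-resolved
`MomentBounds6 G r u` of the ceilings stub) hold at the target unit; mere two-sided comparability `c ≤ a/u ≤ C` does
not suffice by this argument (a floor for one witness does not control its dilates).

This file:
* `lowerBounds_of_tendsto_div_one` / `lowerBounds_of_tendsto_div` — floors with compact witnesses at `a` ∧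
  `MomentBounds G r u` ∧ `u → 0⁺` ∧ `a/u → c₀ > 0` ⇒ `LowerBounds G r u` (general `c₀` by the exact dilation
  covariance of `BalabanLadderUVSeamRecUnitDilation`);
* `lowerBounds_of_tendsto_div_of_momentBounds6` — the same fed by `MomentBounds6 G r u` (landed
  `momentBounds_of_momentBounds6`);
* `uRec_pos`, `tendsto_sizeLog_one_atBot`, `tendsto_uRec` — the unit of record is positive and tends to `0`;
* `lowerBounds_uRec_of_engine`, `stubFloors_of_engine` — THE RESHAPED FLOORS STUB: the conclusion of the registered
  `stub_floors` (`∃ r : LatticeRep SU(2), LowerBounds SU(2) r uRec`) follows from the conclusion of the registered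
  `stub_ceilings` (plane-resolved ceilings at `uRec`) plus ONE representation of `SU(2)` with compact-witness floors at
  an engine unit `a` with `a β / uRec β → c₀ > 0`.  `UV` enters only through the ceilings.
-/

set_option autoImplicit false

noncomputable section

open scoped SchwartzMap BigOperators
open MeasureTheory Filter Topology Metric
open Literature.MathematicalPhysics.QuantumFieldTheory Literature.MathematicalPhysics.QuantumLattice
open Literature.Probability.LatticeModels (box Site mem_box card_box)
open Summit.QuantumFields.YangMills.Cruxes.OSLegsFromFemtoAndGap.DlrCollarTransfer
open Summit.QuantumFields.YangMills.Theorems.OSLegsFromFemtoAndGap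

namespace Summit.QuantumFields.YangMills.Cruxes.UVSeamRec.UnitTransfer

variable {G : Type} [Group G] [TopologicalSpace G] [IsTopologicalGroup G] [CompactSpace G]
  [MeasurableSpace G] [BorelSpace G]

/-! ### The transfer theorems -/

/-- **Floors transfer at ratio one.**  Floors with compactly supported witnesses at unit `a`, density ceilings at unit
`u`, `u → 0⁺` and `a/u → 1` give `LowerBounds G r u` (same witnesses, half the floors). [folklore] -/
theorem lowerBounds_of_tendsto_div_one (r : LatticeRep G) {a u : ℝ → ℝ} (ha : ∀ β, 0 < a β) (hu : ∀ β, 0 < u β)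
    (hu0 : Tendsto u atTop (𝓝 0)) (hau : Tendsto (fun β => a β / u β) atTop (𝓝 1))
    (hMB : MomentBounds G r u)
    (h2 : ∃ (v : 𝓢(EuclideanSpace ℝ (Fin 4), ℝ)) (ε β₅ Λ₅ : ℝ),
      HasCompactSupport (v : EuclideanSpace ℝ (Fin 4) → ℝ) ∧
      tsupport (v : EuclideanSpace ℝ (Fin 4) → ℝ) ⊆ {y : EuclideanSpace ℝ (Fin 4) | 0 < y 0} ∧ 0 < ε ∧
      ∀ β : ℝ, β₅ ≤ β → ∀ L : ℕ, Λ₅ ≤ a β * L → ε ≤ Q2 G r β L (a β) (thetaTest 4 v) v)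
    (h3 : ∃ (f g h : 𝓢(EuclideanSpace ℝ (Fin 4), ℝ)) (ε β₅ Λ₅ : ℝ),
      HasCompactSupport (f : EuclideanSpace ℝ (Fin 4) → ℝ) ∧ HasCompactSupport (g : EuclideanSpace ℝ (Fin 4) → ℝ) ∧
      HasCompactSupport (h : EuclideanSpace ℝ (Fin 4) → ℝ) ∧
      Disjoint (tsupport (f : EuclideanSpace ℝ (Fin 4) → ℝ)) (tsupport (g : EuclideanSpace ℝ (Fin 4) → ℝ)) ∧
      Disjoint (tsupport (g : EuclideanSpace ℝ (Fin 4) → ℝ)) (tsupport (h : EuclideanSpace ℝ (Fin 4) → ℝ)) ∧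
      Disjoint (tsupport (f : EuclideanSpace ℝ (Fin 4) → ℝ)) (tsupport (h : EuclideanSpace ℝ (Fin 4) → ℝ)) ∧ 0 < ε ∧
      ∀ β : ℝ, β₅ ≤ β → ∀ L : ℕ, Λ₅ ≤ a β * L → ε ≤ |Q3 G r β L (a β) f g h|) :
    LowerBounds G r u := by
  obtain ⟨v, ε, β₅, Λ₅, hvK, hvpos, hε, hfl⟩ := h2
  obtain ⟨f, g, h, ε', β₅', Λ₅', hfK, hgK, hhK, hfg, hgh, hfh, hε', hfl'⟩ := h3
  obtain ⟨b₂, l₂, H₂⟩ := twoPoint_transfer r ha hu hu0 hau hMB v hvK hvpos hε hfl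
  obtain ⟨b₃, l₃, H₃⟩ := threePoint_transfer r ha hu hu0 hau hMB f g h hfK hgK hhK hfg hgh hfh hε' hfl'
  exact ⟨⟨v, ε / 2, b₂, l₂, hvpos, by positivity, H₂⟩, ⟨f, g, h, ε' / 2, b₃, l₃, hfg, hgh, hfh, by positivity, H₃⟩⟩

/-- **Floors transfer along an asymptotically proportional unit.**  Floors with compactly supported witnesses at
unit `a`, density ceilings `MomentBounds G r u` at unit `u`, `u → 0⁺` and `a β / u β → c₀ > 0` give `LowerBounds G r u`
(witnesses dilated by `c₀`). [folklore] -/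
theorem lowerBounds_of_tendsto_div (r : LatticeRep G) {a u : ℝ → ℝ} {c₀ : ℝ} (hc₀ : 0 < c₀) (ha : ∀ β, 0 < a β)
    (hu : ∀ β, 0 < u β) (hu0 : Tendsto u atTop (𝓝 0)) (hau : Tendsto (fun β => a β / u β) atTop (𝓝 c₀))
    (hMB : MomentBounds G r u)
    (h2 : ∃ (v : 𝓢(EuclideanSpace ℝ (Fin 4), ℝ)) (ε β₅ Λ₅ : ℝ),
      HasCompactSupport (v : EuclideanSpace ℝ (Fin 4) → ℝ) ∧
      tsupport (v : EuclideanSpace ℝ (Fin 4) → ℝ) ⊆ {y : EuclideanSpace ℝ (Fin 4) | 0 < y 0} ∧ 0 < ε ∧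
      ∀ β : ℝ, β₅ ≤ β → ∀ L : ℕ, Λ₅ ≤ a β * L → ε ≤ Q2 G r β L (a β) (thetaTest 4 v) v)
    (h3 : ∃ (f g h : 𝓢(EuclideanSpace ℝ (Fin 4), ℝ)) (ε β₅ Λ₅ : ℝ),
      HasCompactSupport (f : EuclideanSpace ℝ (Fin 4) → ℝ) ∧ HasCompactSupport (g : EuclideanSpace ℝ (Fin 4) → ℝ) ∧
      HasCompactSupport (h : EuclideanSpace ℝ (Fin 4) → ℝ) ∧
      Disjoint (tsupport (f : EuclideanSpace ℝ (Fin 4) → ℝ)) (tsupport (g : EuclideanSpace ℝ (Fin 4) → ℝ)) ∧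
      Disjoint (tsupport (g : EuclideanSpace ℝ (Fin 4) → ℝ)) (tsupport (h : EuclideanSpace ℝ (Fin 4) → ℝ)) ∧
      Disjoint (tsupport (f : EuclideanSpace ℝ (Fin 4) → ℝ)) (tsupport (h : EuclideanSpace ℝ (Fin 4) → ℝ)) ∧ 0 < ε ∧
      ∀ β : ℝ, β₅ ≤ β → ∀ L : ℕ, Λ₅ ≤ a β * L → ε ≤ |Q3 G r β L (a β) f g h|) :
    LowerBounds G r u := by
  -- pass to the unit `c₀ · u`, asymptotically EQUAL to `a`, then undo the dilation exactly
  have hu' : ∀ β, 0 < c₀ * u β := fun β => mul_pos hc₀ (hu β)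
  have hu0' : Tendsto (fun β => c₀ * u β) atTop (𝓝 0) := by
    simpa using hu0.const_mul c₀
  have hau' : Tendsto (fun β => a β / (c₀ * u β)) atTop (𝓝 1) := by
    have : Tendsto (fun β => c₀⁻¹ * (a β / u β)) atTop (𝓝 (c₀⁻¹ * c₀)) := hau.const_mul c₀⁻¹
    rw [inv_mul_cancel₀ hc₀.ne'] at this
    refine this.congr' (Eventually.of_forall fun β => ?_)
    field_simp
  have hMB' : MomentBounds G r (fun β => c₀ * u β) := (UnitDilation.momentBounds_const_mul_iff r u hc₀).2 hMB
  exact UnitDilation.lowerBounds_of_const_mul r hc₀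
    (lowerBounds_of_tendsto_div_one r ha hu' hu0' hau' hMB' h2 h3)

/-- **Floors transfer fed by the plane-resolved ceilings** `MomentBounds6 G r u` (the output of the ceilings stub). [folklore] -/
theorem lowerBounds_of_tendsto_div_of_momentBounds6 (r : LatticeRep G) {a u : ℝ → ℝ} {c₀ : ℝ} (hc₀ : 0 < c₀)
    (ha : ∀ β, 0 < a β) (hu : ∀ β, 0 < u β) (hu0 : Tendsto u atTop (𝓝 0))
    (hau : Tendsto (fun β => a β / u β) atTop (𝓝 c₀)) (hMB : MomentBounds6 G r u)
    (h2 : ∃ (v : 𝓢(EuclideanSpace ℝ (Fin 4), ℝ)) (ε β₅ Λ₅ : ℝ),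
      HasCompactSupport (v : EuclideanSpace ℝ (Fin 4) → ℝ) ∧
      tsupport (v : EuclideanSpace ℝ (Fin 4) → ℝ) ⊆ {y : EuclideanSpace ℝ (Fin 4) | 0 < y 0} ∧ 0 < ε ∧
      ∀ β : ℝ, β₅ ≤ β → ∀ L : ℕ, Λ₅ ≤ a β * L → ε ≤ Q2 G r β L (a β) (thetaTest 4 v) v)
    (h3 : ∃ (f g h : 𝓢(EuclideanSpace ℝ (Fin 4), ℝ)) (ε β₅ Λ₅ : ℝ),
      HasCompactSupport (f : EuclideanSpace ℝ (Fin 4) → ℝ) ∧ HasCompactSupport (g : EuclideanSpace ℝ (Fin 4) → ℝ) ∧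
      HasCompactSupport (h : EuclideanSpace ℝ (Fin 4) → ℝ) ∧
      Disjoint (tsupport (f : EuclideanSpace ℝ (Fin 4) → ℝ)) (tsupport (g : EuclideanSpace ℝ (Fin 4) → ℝ)) ∧
      Disjoint (tsupport (g : EuclideanSpace ℝ (Fin 4) → ℝ)) (tsupport (h : EuclideanSpace ℝ (Fin 4) → ℝ)) ∧
      Disjoint (tsupport (f : EuclideanSpace ℝ (Fin 4) → ℝ)) (tsupport (h : EuclideanSpace ℝ (Fin 4) → ℝ)) ∧ 0 < ε ∧
      ∀ β : ℝ, β₅ ≤ β → ∀ L : ℕ, Λ₅ ≤ a β * L → ε ≤ |Q3 G r β L (a β) f g h|) :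
    LowerBounds G r u :=
  lowerBounds_of_tendsto_div r hc₀ ha hu hu0 hau (momentBounds_of_momentBounds6 r u hMB) h2 h3


/-! ### The unit of record -/

/-- The unit of record `uRec β = exp (sizeLog β 1)` is positive. [folklore] -/
theorem uRec_pos (β : ℝ) : 0 < Transport.uRec β := Real.exp_pos _

/-- The two-loop size label at `L = 1`, `−β/(4b₀) − (b₁/(2b₀²)) log(2b₀/β)`, tends to `−∞` (the linear term wins
against the logarithm). [folklore] -/
theorem tendsto_sizeLog_one_atBot :
    Tendsto (fun β : ℝ => Summit.QuantumFields.YangMills.Theorems.FemtoTransferGap.sizeLog β 1) atTop atBot := by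
  have hb0 : (0 : ℝ) < Summit.QuantumFields.YangMills.Theorems.FemtoTransferGap.b0 := by
    unfold Summit.QuantumFields.YangMills.Theorems.FemtoTransferGap.b0; positivity
  set B0 : ℝ := Summit.QuantumFields.YangMills.Theorems.FemtoTransferGap.b0 with hB0
  set K : ℝ := Summit.QuantumFields.YangMills.Theorems.FemtoTransferGap.b1 / (2 * B0 ^ 2) with hK
  have h4 : (0 : ℝ) < 4 * B0 := by positivity
  have hf : Tendsto (fun β : ℝ => -(β / (4 * B0))) atTop atBot :=
    tendsto_neg_atTop_atBot.comp (tendsto_id.atTop_div_const h4)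
  have hg : (fun β : ℝ => K * Real.log β - K * Real.log (2 * B0)) =o[atTop] (fun β : ℝ => -(β / (4 * B0))) := by
    have h1 : (fun β : ℝ => K * Real.log β - K * Real.log (2 * B0)) =o[atTop] (fun β : ℝ => β) := by
      have hlog : (fun β : ℝ => K * Real.log β) =o[atTop] (fun β : ℝ => β) :=
        Real.isLittleO_log_id_atTop.const_mul_left K
      have hc : (fun _ : ℝ => K * Real.log (2 * B0)) =o[atTop] (fun β : ℝ => β) :=
        Asymptotics.isLittleO_const_left.2
          (Or.inr (show Tendsto (fun β : ℝ => ‖β‖) atTop atTop from tendsto_norm_atTop_atTop))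
      exact hlog.sub hc
    have h2 : (fun β : ℝ => β) =O[atTop] (fun β : ℝ => -(β / (4 * B0))) := by
      refine Asymptotics.IsBigO.of_bound (4 * B0) (Eventually.of_forall fun β => ?_)
      rw [norm_neg, norm_div, Real.norm_of_nonneg h4.le, mul_div_cancel₀ _ h4.ne']
    exact h1.trans_isBigO h2
  have hsum : Tendsto ((fun β : ℝ => -(β / (4 * B0))) + fun β : ℝ => K * Real.log β - K * Real.log (2 * B0))
      atTop atBot :=
    ((Asymptotics.IsEquivalent.refl.add_isLittleO hg).symm).tendsto_atBot hf
  refine hsum.congr' ?_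
  filter_upwards [eventually_gt_atTop (0 : ℝ)] with β hβ
  simp only [Pi.add_apply, Summit.QuantumFields.YangMills.Theorems.FemtoTransferGap.sizeLog, hK, hB0, Nat.cast_one,
    Real.log_one]
  rw [Real.log_div (mul_pos two_pos hb0).ne' hβ.ne']
  ring

/-- The unit of record tends to `0` as `β → ∞`. [folklore] -/
theorem tendsto_uRec : Tendsto Transport.uRec atTop (𝓝 0) :=
  Real.tendsto_exp_atBot.comp tendsto_sizeLog_one_atBot

/-- **Floors at the unit of record from an engine unit.**  Compact-witness floors at a unit `a` with
`a β / uRec β → c₀ > 0` and the plane-resolved ceilings at `uRec` give `LowerBounds G r uRec`. [folklore] -/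
theorem lowerBounds_uRec_of_engine (r : LatticeRep G) {a : ℝ → ℝ} {c₀ : ℝ} (hc₀ : 0 < c₀) (ha : ∀ β, 0 < a β)
    (hau : Tendsto (fun β => a β / Transport.uRec β) atTop (𝓝 c₀)) (hMB : MomentBounds6 G r Transport.uRec)
    (h2 : ∃ (v : 𝓢(EuclideanSpace ℝ (Fin 4), ℝ)) (ε β₅ Λ₅ : ℝ),
      HasCompactSupport (v : EuclideanSpace ℝ (Fin 4) → ℝ) ∧
      tsupport (v : EuclideanSpace ℝ (Fin 4) → ℝ) ⊆ {y : EuclideanSpace ℝ (Fin 4) | 0 < y 0} ∧ 0 < ε ∧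
      ∀ β : ℝ, β₅ ≤ β → ∀ L : ℕ, Λ₅ ≤ a β * L → ε ≤ Q2 G r β L (a β) (thetaTest 4 v) v)
    (h3 : ∃ (f g h : 𝓢(EuclideanSpace ℝ (Fin 4), ℝ)) (ε β₅ Λ₅ : ℝ),
      HasCompactSupport (f : EuclideanSpace ℝ (Fin 4) → ℝ) ∧ HasCompactSupport (g : EuclideanSpace ℝ (Fin 4) → ℝ) ∧
      HasCompactSupport (h : EuclideanSpace ℝ (Fin 4) → ℝ) ∧
      Disjoint (tsupport (f : EuclideanSpace ℝ (Fin 4) → ℝ)) (tsupport (g : EuclideanSpace ℝ (Fin 4) → ℝ)) ∧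
      Disjoint (tsupport (g : EuclideanSpace ℝ (Fin 4) → ℝ)) (tsupport (h : EuclideanSpace ℝ (Fin 4) → ℝ)) ∧
      Disjoint (tsupport (f : EuclideanSpace ℝ (Fin 4) → ℝ)) (tsupport (h : EuclideanSpace ℝ (Fin 4) → ℝ)) ∧ 0 < ε ∧
      ∀ β : ℝ, β₅ ≤ β → ∀ L : ℕ, Λ₅ ≤ a β * L → ε ≤ |Q3 G r β L (a β) f g h|) :
    LowerBounds G r Transport.uRec :=
  lowerBounds_of_tendsto_div_of_momentBounds6 r hc₀ ha uRec_pos tendsto_uRec hau hMB h2 h3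

/-- **The reshaped floors stub of the `UVSeamRec` skeleton.**  The conclusion of the registered `stub_floors`
(`∃ r : LatticeRep SU(2), LowerBounds SU(2) r uRec`) follows from (i) the conclusion of the registered `stub_ceilings`
(plane-resolved ceilings at `uRec` for every lattice representation of `SU(2)`) and (ii) ONE lattice representation of
`SU(2)` carrying compact-witness floors at an engine unit `a` with `a β / uRec β → c₀ > 0` (the NT line's femto floors
via the landed `stub_lower`, plus two-loop asymptotic scaling of its unit).  `UV` is consumed only through (i). [folklore] -/
theorem stubFloors_of_engine
    (hceil : letI : MeasurableSpace (Matrix.specialUnitaryGroup (Fin 2) ℂ) := borel _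
      haveI : BorelSpace (Matrix.specialUnitaryGroup (Fin 2) ℂ) := ⟨rfl⟩
      ∀ r : LatticeRep (Matrix.specialUnitaryGroup (Fin 2) ℂ),
        MomentBounds6 (Matrix.specialUnitaryGroup (Fin 2) ℂ) r Transport.uRec)
    (heng : letI : MeasurableSpace (Matrix.specialUnitaryGroup (Fin 2) ℂ) := borel _
      haveI : BorelSpace (Matrix.specialUnitaryGroup (Fin 2) ℂ) := ⟨rfl⟩
      ∃ (r : LatticeRep (Matrix.specialUnitaryGroup (Fin 2) ℂ)) (a : ℝ → ℝ) (c₀ : ℝ), 0 < c₀ ∧ (∀ β, 0 < a β) ∧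
        Tendsto (fun β => a β / Transport.uRec β) atTop (𝓝 c₀) ∧
        (∃ (v : 𝓢(EuclideanSpace ℝ (Fin 4), ℝ)) (ε β₅ Λ₅ : ℝ),
          HasCompactSupport (v : EuclideanSpace ℝ (Fin 4) → ℝ) ∧
          tsupport (v : EuclideanSpace ℝ (Fin 4) → ℝ) ⊆ {y : EuclideanSpace ℝ (Fin 4) | 0 < y 0} ∧ 0 < ε ∧
          ∀ β : ℝ, β₅ ≤ β → ∀ L : ℕ, Λ₅ ≤ a β * L →
            ε ≤ Q2 (Matrix.specialUnitaryGroup (Fin 2) ℂ) r β L (a β) (thetaTest 4 v) v) ∧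
        (∃ (f g h : 𝓢(EuclideanSpace ℝ (Fin 4), ℝ)) (ε β₅ Λ₅ : ℝ),
          HasCompactSupport (f : EuclideanSpace ℝ (Fin 4) → ℝ) ∧
          HasCompactSupport (g : EuclideanSpace ℝ (Fin 4) → ℝ) ∧
          HasCompactSupport (h : EuclideanSpace ℝ (Fin 4) → ℝ) ∧
          Disjoint (tsupport (f : EuclideanSpace ℝ (Fin 4) → ℝ)) (tsupport (g : EuclideanSpace ℝ (Fin 4) → ℝ)) ∧
          Disjoint (tsupport (g : EuclideanSpace ℝ (Fin 4) → ℝ)) (tsupport (h : EuclideanSpace ℝ (Fin 4) → ℝ)) ∧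
          Disjoint (tsupport (f : EuclideanSpace ℝ (Fin 4) → ℝ)) (tsupport (h : EuclideanSpace ℝ (Fin 4) → ℝ)) ∧
          0 < ε ∧ ∀ β : ℝ, β₅ ≤ β → ∀ L : ℕ, Λ₅ ≤ a β * L →
            ε ≤ |Q3 (Matrix.specialUnitaryGroup (Fin 2) ℂ) r β L (a β) f g h|)) :
    letI : MeasurableSpace (Matrix.specialUnitaryGroup (Fin 2) ℂ) := borel _
    haveI : BorelSpace (Matrix.specialUnitaryGroup (Fin 2) ℂ) := ⟨rfl⟩
    ∃ r : LatticeRep (Matrix.specialUnitaryGroup (Fin 2) ℂ),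
      LowerBounds (Matrix.specialUnitaryGroup (Fin 2) ℂ) r Transport.uRec := by
  letI : MeasurableSpace (Matrix.specialUnitaryGroup (Fin 2) ℂ) := borel _
  haveI : BorelSpace (Matrix.specialUnitaryGroup (Fin 2) ℂ) := ⟨rfl⟩
  obtain ⟨r, a, c₀, hc₀, ha, hau, h2, h3⟩ := heng
  exact ⟨r, lowerBounds_uRec_of_engine r hc₀ ha hau (hceil r) h2 h3⟩

end Summit.QuantumFields.YangMills.Cruxes.UVSeamRec.UnitTransfer

end
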